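import Literature.Claims.NS.Davlatov2020
import Literature.Analysis.FunctionSpaces.TorusSobolevL6Spectral
import Literature.Analysis.FunctionSpaces.TorusSobolevNormProofs
import Literature.Analysis.FunctionSpaces.TorusSobolevNormFacts
import Literature.Analysis.FluidPDE.CriticalSpacesProofs
import Literature.Analysis.FluidPDE.NSHopfExistenceProofs
import Literature.Analysis.FunctionSpaces.TorusSpaceTimeFields
import Literature.Analysis.FunctionSpaces.TorusSobolevL6
import HarnessLib

/-!
# Solo salvage for claim C76 `Davlatov2020` (cell `ns-claims`, D-0090): the classical
# bookkeeping around the locator, kernel-discharged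

Claim skeleton: `Literature/Claims/NS/Davlatov2020.lean` (typist `ns-claims-typist-9`, p469445):
Sh. O. Davlatov, «Существование решения уравнения Навье-Стокса», arXiv:1603.09665 v3 (2020), Theorems
3–4 p. 5 (unique weak solution in `C([0,T];V)` / classical solution, periodic cube, general force); the
locator of record is Step 3 (`Step3_TimeDerivL1`, §6 «1)» p. 14 l.716–719: «from (6.1) it follows that
u′ ∈ C([0,T];(L¹(Ω))³)»), a class inference from the scalar mean identity (6.2).

This file (seat `ns-claims-salvage-p2`, salvage lane of C76) kernel-discharges the CLASSICAL items
around that locator which the composition `claim_of_steps` / `clay_of_claimed_of_delta` consumes, so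
that the adjudication rests on Step 3 alone:

* `inVcapH2_inH` — the bookkeeping hypothesis `hVH` of `theorem3_of_steps` / `claim_of_steps`:
  `V ∩ H² ⊂ H` on `𝕋³` (`H² ⊂ L²`, tree `Torus.MemSobolev.memLp_two_holds`);
* `zeroForceInClass_holds : ZeroForceInClass` — the hypothesis `h0` of `clay_of_claimed_of_delta`
  (`f ≡ 0 ∈ C([0,T];H² ∩ V′)`);
* `step6_holds : Step6_CL6` — Step 6, p. 15 l.750 «u ∈ C([0,T];(L⁶)³) поскольку V ⊂ (H¹)³ ⊂ (L⁶)³»: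
  `C([0,T];H¹) ⊂ C([0,T];L⁶)` on `𝕋³`, from the spectral Sobolev embedding
  `Torus.exists_eLpNorm_six_le_eSobolevNorm_one` (Robinson–Rodrigo–Sadowski 2016 Thm 1.19 / Evans
  §5.6.1; `Literature/Analysis/FunctionSpaces/TorusSobolevL6Spectral.lean`). ORIGINAL SOURCE of the
  step: the Sobolev embedding theorem (Sobolev 1938; Evans 2010 §5.6), not the claim.

With these, `claim_of_steps` needs exactly Steps 1, 2, 3, 4, 5, 7, 8 and the sub-claim `UPrimeZeroInH`
(`claim_of_steps_inputs`). Solo lane (`Theorems/SoloSalvage<Slug>.lean`, no item).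

WHAT THIS IS NOT: not a claim about NS regularity or blow-up; not a claim about any author beyond the
typed locator.
-/

noncomputable section

open MeasureTheory Set Filter Function
open scoped ENNReal NNReal Topology

-- The mandated landing namespace repeats the summit name by design (D-0017).
set_option linter.dupNamespace false

namespace Summit.NavierStokesRegularity.NavierStokesRegularity.Theorems

namespace Davlatov2020

open Literature.Claims.NS.Davlatov2020 Literature.Analysis Literature.Analysis.FluidPDE
  Literature.Analysis.FunctionSpaces

/-- **`V ∩ H² ⊂ H` on `𝕋³`** — the bookkeeping hypothesis `hVH` of
`Literature.Claims.NS.Davlatov2020.theorem3_of_steps` / `claim_of_steps`: an `H²` weakly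
divergence-free field is square integrable and weakly divergence free (`H^s ⊂ L²` for `s ≥ 0`,
Parseval; Grafakos 2014 Prop. 3.2.7). [cite: Davlatov2016NSPeriodic, §1 p. 4 (V₁ ⊂ V ⊂ H)] -/
theorem inVcapH2_inH (v : UnitAddTorus (Fin 3) → EuclideanSpace ℝ (Fin 3)) (hv : InVcapH2 v) :
    InH v :=
  ⟨FluidPDE.memLp_complexify_comp_iff.1 (Torus.MemSobolev.memLp_two_holds hv.1 (by norm_num)), hv.2⟩

/-- **The zero force is admissible for Theorem 4** (`f ≡ 0 ∈ C([0,T];H² ∩ V′)`): the hypothesis `h0`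
of `Literature.Claims.NS.Davlatov2020.clay_of_claimed_of_delta`. [cite: Davlatov2016NSPeriodic, Thm 4 p. 5] -/
theorem zeroForceInClass_holds : ZeroForceInClass := by
  intro T _hT
  have h0 : (fun t : ℝ => EuclideanSpace.complexify ∘
      (0 : ℝ → UnitAddTorus (Fin 3) → EuclideanSpace ℝ (Fin 3)) t) =
      fun _ => (0 : UnitAddTorus (Fin 3) → EuclideanSpace ℂ (Fin 3)) := by
    funext t; funext x; simp
  refine ⟨?_, fun t _ θ _ => by simp⟩
  rw [h0]
  refine ⟨fun t _ => Torus.memSobolev_zero_fun 2, fun t₀ _ => ?_⟩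
  simp only [sub_self, Torus.eSobolevNorm_zero_fun]
  exact tendsto_const_nhds

/-- **Step 6 HOLDS (p. 15 l.750): `C([0,T];V) ⊂ C([0,T];(L⁶)³)` on `𝕋³`** — every field continuous on
`[0,T]` into the spectral `H¹` is continuous into `L⁶` (Sobolev embedding `H¹(𝕋³) ⊂ L⁶(𝕋³)` applied
slice-wise and to differences of slices; tree `Torus.exists_eLpNorm_six_le_eSobolevNorm_one`).
Original source: Sobolev's embedding theorem (Evans 2010 §5.6.1 Thm 1; RRS 2016 Thm 1.19).
[cite: Davlatov2016NSPeriodic, §6 1) p. 15 l.750] -/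
theorem step6_holds : Step6_CL6 := by
  intro T _hT u hu
  obtain ⟨K, hK⟩ := Torus.exists_eLpNorm_six_le_eSobolevNorm_one (d := Fin 3) (by simp)
  refine ⟨fun t ht => (hK (u t) (hu.1 t ht)).1, fun t₀ ht₀ => ?_⟩
  have hsub : ∀ t : ℝ, (EuclideanSpace.complexify ∘ (u t - u t₀)) =
      (EuclideanSpace.complexify ∘ u t) - (EuclideanSpace.complexify ∘ u t₀) := by
    intro t; funext x; simp
  -- the `H¹` norm of the difference tends to zero, hence so does `K` times it
  have hlim : Tendsto (fun t => (K : ℝ≥0∞) *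
      Torus.eSobolevNorm 1 ((EuclideanSpace.complexify ∘ u t) - (EuclideanSpace.complexify ∘ u t₀)))
      (𝓝[Icc 0 T] t₀) (𝓝 0) := by
    have h := ENNReal.Tendsto.const_mul (hu.2 t₀ ht₀) (Or.inr ENNReal.coe_ne_top) (a := (K : ℝ≥0∞))
    rwa [mul_zero] at h
  refine tendsto_of_tendsto_of_tendsto_of_le_of_le' tendsto_const_nhds hlim
    (Eventually.of_forall fun _ => zero_le) ?_
  filter_upwards [self_mem_nhdsWithin] with t ht
  have hmem : Torus.MemSobolev 1 (EuclideanSpace.complexify ∘ (u t - u t₀)) := by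
    rw [hsub]; exact Torus.MemSobolev.sub_holds (hu.1 t ht) (hu.1 t₀ ht₀)
  have h := (hK (u t - u t₀) hmem).2
  rwa [hsub] at h


/-! ### Step 1 (Theorem 2): Leray–Hopf existence, for space–time measurable forces -/

/-- A `C([0,T];L²)` family on the torus is bounded in `L²` on `[0,T]` (finite subcover by the balls
`{t | ‖f t − f s‖₂ < 1}`). [folklore] -/
private theorem exists_forall_eLpNorm_le_of_forceClass {T : ℝ}
    {f : ℝ → UnitAddTorus (Fin 3) → EuclideanSpace ℝ (Fin 3)}
    (hf : FluidPDE.ContinuousInLpOn (Icc 0 T) 2 f) :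
    ∃ M : ℝ≥0, ∀ t ∈ Icc 0 T, eLpNorm (f t) 2 volume ≤ M := by
  set U : ℝ → Set ℝ := fun s => {t | eLpNorm (f t - f s) 2 volume < 1} with hU_def
  have hU : ∀ s ∈ Icc 0 T, U s ∈ 𝓝[Icc 0 T] s := fun s hs => (hf.2 s hs) (Iio_mem_nhds one_pos)
  obtain ⟨F, hFK, hcover⟩ := isCompact_Icc.elim_nhdsWithin_subcover U hU
  have hfin : ∀ s ∈ Icc 0 T, eLpNorm (f s) 2 volume < ⊤ := fun s hs => (hf.1 s hs).2
  set M : ℝ≥0∞ := ∑ s ∈ F, (1 + eLpNorm (f s) 2 volume) with hM_def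
  have hMtop : M < ⊤ :=
    ENNReal.sum_lt_top.2 fun s hs => ENNReal.add_lt_top.2 ⟨ENNReal.one_lt_top, hfin s (hFK s hs)⟩
  refine ⟨M.toNNReal, fun t ht => ?_⟩
  rw [ENNReal.coe_toNNReal hMtop.ne]
  obtain ⟨s, hsF, hts⟩ : ∃ s ∈ F, t ∈ U s := by
    have h := hcover ht
    simp only [mem_iUnion, exists_prop] at h
    exact h
  have hsK : s ∈ Icc 0 T := hFK s hsF
  calc eLpNorm (f t) 2 volume = eLpNorm ((f t - f s) + f s) 2 volume := by rw [sub_add_cancel]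
    _ ≤ eLpNorm (f t - f s) 2 volume + eLpNorm (f s) 2 volume :=
        eLpNorm_add_le ((hf.1 t ht).1.sub (hf.1 s hsK).1) (hf.1 s hsK).1 one_le_two
    _ ≤ 1 + eLpNorm (f s) 2 volume := by
        gcongr
        exact le_of_lt hts
    _ ≤ M := Finset.single_le_sum (f := fun s => 1 + eLpNorm (f s) 2 volume)
        (fun _ _ => zero_le) hsF

/-- The weak formulation sees the force only through its slices at times `t ∈ (0,T)`: two forces
agreeing there give the same forced weak solutions. [folklore] -/
private theorem isWeakNSSolutionForcedOn_congr_force {T ν : ℝ}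
    {f g : ℝ → UnitAddTorus (Fin 3) → EuclideanSpace ℝ (Fin 3)}
    {u₀ : UnitAddTorus (Fin 3) → EuclideanSpace ℝ (Fin 3)}
    {u : ℝ → UnitAddTorus (Fin 3) → EuclideanSpace ℝ (Fin 3)} (hfg : ∀ t ∈ Ioo 0 T, g t = f t)
    (h : Torus.IsWeakNSSolutionForcedOn T ν g u₀ u) : Torus.IsWeakNSSolutionForcedOn T ν f u₀ u := by
  refine ⟨h.1, h.2.1, h.2.2.1, fun ψ hψ hdiv => ?_⟩
  convert h.2.2.2 ψ hψ hdiv using 2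
  exact setIntegral_congr_fun measurableSet_Ioo fun t ht => by simp only [hfg t ht]

/-- **Step 1 (Theorem 2, p. 5 / §5 pp. 10–13) for space–time measurable forces — CLASSICAL**
(Leray 1934 §V; Hopf 1951; Temam 1977 Ch. III Thm 3.1): for `T > 0`, a force `f ∈ C([0,T];L²)` with
weakly divergence-free slices WHOSE SPACE–TIME LIFT IS A.E.-STRONGLY MEASURABLE on `(0,T) × ℝ³` (the
hypothesis the paper takes for granted and the typed `ForceClass` does not record), and `u₀ ∈ H`,
problem (4.4)–(4.7) has a weak solution in the typed class `L²(0,T;V) ∩ L^∞(0,T;H)`. Kernel route: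
freeze the force after time `T` (`t ↦ f (T)` for `t ≥ T`; measurable and square integrable on every
`(0,T')`), apply the tree's Hopf existence theorem on `𝕋³` (`hopf_existence_torus_holds`, Galerkin,
PROVED) at `ν = 1`, restrict the global Leray–Hopf solution to `[0,T)` and project its fields
(`weak`, `energy_bound`, `memL2Sobolev`); the frozen force agrees with `f` on `(0,T)`
(`isWeakNSSolutionForcedOn_congr_force`). [cite: Davlatov2016NSPeriodic, Thm 2 p. 5; §5 pp. 10–13] -/
theorem step1_of_measurable (T : ℝ) (hT : 0 < T)
    (f : ℝ → UnitAddTorus (Fin 3) → EuclideanSpace ℝ (Fin 3))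
    (u₀ : UnitAddTorus (Fin 3) → EuclideanSpace ℝ (Fin 3)) (hf : ForceClass T f)
    (hfm : AEStronglyMeasurable (Torus.stLift f) (volume.restrict (Ioo 0 T ×ˢ univ)))
    (hu₀ : InH u₀) :
    ∃ u : ℝ → UnitAddTorus (Fin 3) → EuclideanSpace ℝ (Fin 3), IsWeakSolution T f u₀ u := by
  -- the force frozen after time `T`
  set g : ℝ → UnitAddTorus (Fin 3) → EuclideanSpace ℝ (Fin 3) := fun t => if t < T then f t else f T
    with hg
  have hgf : ∀ t ∈ Ioo 0 T, g t = f t := fun t ht => by simp [hg, ht.2]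
  have hTmem : T ∈ Icc 0 T := ⟨hT.le, le_rfl⟩
  -- measurability of the frozen force on `(0,∞) × ℝ³`
  have hmeas : AEStronglyMeasurable (Torus.stLift g) (volume.restrict (Ioi 0 ×ˢ univ)) := by
    have hsplit : (Ioi (0 : ℝ) ×ˢ (univ : Set (EuclideanSpace ℝ (Fin 3)))) =
        (Ioo 0 T ×ˢ univ) ∪ (Ici T ×ˢ univ) := by
      ext ⟨t, y⟩
      simp only [mem_prod, mem_Ioi, mem_univ, and_true, mem_union, mem_Ioo, mem_Ici]
      constructor
      · intro ht
        rcases lt_or_ge t T with h | h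
        · exact Or.inl ⟨ht, h⟩
        · exact Or.inr h
      · rintro (⟨ht, -⟩ | ht)
        · exact ht
        · exact hT.trans_le ht
    rw [hsplit, aestronglyMeasurable_union_iff]
    constructor
    · refine hfm.congr ?_
      filter_upwards [ae_restrict_mem (measurableSet_Ioo.prod MeasurableSet.univ)] with p hp
      rcases p with ⟨t, y⟩
      have ht : t ∈ Ioo 0 T := (mem_prod.1 hp).1
      simp [Torus.stLift, hgf t ht]
    · have hsteady : AEStronglyMeasurable (Torus.stLift (fun _ : ℝ => f T))
          (volume.restrict (Ici T ×ˢ (univ : Set (EuclideanSpace ℝ (Fin 3))))) :=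
        Torus.aestronglyMeasurable_stLift_of_uncurry (u := fun _ : ℝ => f T) (hf.1.1 T hTmem).1.comp_snd
      refine hsteady.congr ?_
      filter_upwards [ae_restrict_mem (measurableSet_Ici.prod MeasurableSet.univ)] with p hp
      rcases p with ⟨t, y⟩
      have ht : T ≤ t := (mem_prod.1 hp).1
      simp [Torus.stLift, hg, not_lt.2 ht]
  -- square integrability of the frozen force on every `(0,T')`
  obtain ⟨M, hM⟩ := exists_forall_eLpNorm_le_of_forceClass hf.1
  have hslice : ∀ t : ℝ, 0 < t → ∫⁻ x, ‖g t x‖ₑ ^ 2 ≤ (M : ℝ≥0∞) ^ 2 := by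
    intro t ht
    have hmem : ∃ s ∈ Icc 0 T, g t = f s := by
      by_cases htT : t < T
      · exact ⟨t, ⟨ht.le, htT.le⟩, by simp [hg, htT]⟩
      · exact ⟨T, hTmem, by simp [hg, htT]⟩
    obtain ⟨s, hs, hgs⟩ := hmem
    rw [hgs, ← Torus.eLpNorm_two_pow_two_eq_lintegral]
    exact pow_le_pow_left' (hM s hs) 2
  have hL2 : ∀ T' : ℝ, 0 < T' → ∫⁻ t in Ioo 0 T', ∫⁻ x, ‖g t x‖ₑ ^ 2 < ⊤ := by
    intro T' hT'
    calc ∫⁻ t in Ioo 0 T', ∫⁻ x, ‖g t x‖ₑ ^ 2 ≤ ∫⁻ _ in Ioo 0 T', (M : ℝ≥0∞) ^ 2 := by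
          refine lintegral_mono_ae ?_
          filter_upwards [ae_restrict_mem measurableSet_Ioo] with t ht
          exact hslice t ht.1
      _ < ⊤ := by
          rw [setLIntegral_const]
          exact ENNReal.mul_lt_top (ENNReal.pow_lt_top ENNReal.coe_lt_top) measure_Ioo_lt_top
  -- Hopf's existence theorem on `𝕋³` (tree, proved) and restriction to `[0,T)`
  obtain ⟨u, hu⟩ := hopf_existence_torus_holds 1 one_pos u₀ hu₀.1 hu₀.2 g hmeas hL2
  have hLH : Torus.IsLerayHopfOn T 1 g u₀ u := hu T hT
  obtain ⟨C, hC⟩ := hLH.energy_bound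
  exact ⟨u, isWeakNSSolutionForcedOn_congr_force hgf hLH.weak,
    ⟨(C : ℝ≥0∞), ENNReal.coe_lt_top, hC⟩, hLH.memL2Sobolev⟩

/-- Bookkeeping: with the three discharges of this file, the kernel composition `claim_of_steps`
needs exactly Steps 1, 2, 3, 4, 5, 7, 8 and the printed sub-claim `UPrimeZeroInH` (l.734–748).
[cite: Davlatov2016NSPeriodic, Thms 3–4 p. 5; §6–§7 pp. 14–18] -/
theorem claim_of_steps_inputs (h1 : Step1_Theorem2) (h2 : Step2_Identity62) (h3 : Step3_TimeDerivL1)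
    (h0 : UPrimeZeroInH) (h4 : Step4_C1H) (h5 : Step5_CV) (h7 : Step7_Uniqueness)
    (h8 : Step8_Section7) : ClaimedTheorem :=
  claim_of_steps inVcapH2_inH h1 h2 h3 h0 h4 h5 step6_holds h7 h8

end Davlatov2020

end Summit.NavierStokesRegularity.NavierStokesRegularity.Theorems
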